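import Summits.AnomalousDissipation.AnomalousDissipation.Theorems.BaireTransferRobustLoudUpgradeCategory
import Summits.AnomalousDissipation.AnomalousDissipation.Theorems.BaireTransferRobustLoudUpgradeStubFort
import Summits.AnomalousDissipation.AnomalousDissipation.Theorems.BaireTransferRobustLoudUpgradeStubSteadyCorrespondenceUhc
import Summits.AnomalousDissipation.AnomalousDissipation.Theorems.BaireTransferRobustLoudUpgradeStubLscInterior

/-!
# GENERIC PERSISTENCE for the crux `BaireTransfer.RobustLoudUpgrade` (stmt-AnomalousDissipation-1144):
# a residual, budget-free set of forces on which the mean-zero steady leaf of the upgrade holds with INTERIOR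

Lead c15 of the line `malkin-cone-group-orbits` (category package, wave 2; assembly of the registered stubs `stub_fort`
— `…StubFort`, `stub_steadyCorrespondenceUhc` — `…StubSteadyCorrespondenceUhc`, `stub_lscInterior` — `…StubLscInterior`).

* `steadyCorr S n c` — the steady correspondence of the stratum `n`: pairs `(ν, U) ∈ ℝ × H` with `ν ∈ [1/(n+1), n]`,
  `‖∇U‖² ≤ n²`, `U` a steady weak solution of `NS_ν(f_c)`.  It is upper hemicontinuous in `c` (`stub_steadyCorrespondenceUhc`).
* `genericSet S := ⋂ₙ {c | steadyCorr S n is lower hemicontinuous at c}` — by FORT'S THEOREM (`stub_fort`, M. K. Fort 1951) a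
  RESIDUAL subset of `P_S` (`genericSet_mem_residual`, `dense_genericSet`); it depends on `S` only — not on budgets, ceiling or level.
* `mem_interior_loud_of_mem_genericSet` (**generic persistence**): at every `c ∈ genericSet S`, for ALL `a, E, ε`, a mean-zero
  classical steady witness of `NS_ν(f_c)` at some `ν ∈ (0,a)` with strict budgets `meanEnergy < E`, `meanDissipation > ε` makes `c`
  an INTERIOR point of `loud S a E ε` (`stub_lscInterior`).  Registered sub-goal (def-free, existential form): `genericSteady_interior`.
* `loudSteadyLeaf_inter_genericSet_subset` — the crux's shape ON THE GENERIC SET: `loudSteadyLeaf S a E ε ∩ genericSet S ⊆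
  interior (loud S a (2E) (ε/2))` for `0 < ε` (no stock, uniform in budgets and ceiling).
* §3, Baire consequences of the `F_σ` structure (`…Category.lean`): `interior_loudSteadyLeaf_subset` — **the primed form holds for the
  steady leaf**: `interior (loudSteadyLeaf S a E ε) ⊆ closure (interior (loud S a E ε))`; read contrapositively
  (`not_mem_interior_loudSteadyLeaf_of_wild`): at a force `c₀ ∉ closure (interior LOUD₂)` — a WILD force of the crux — every
  neighbourhood contains forces with NO mean-zero steady witness of budgets `(2E, ε/2)` at ANY viscosity `ν ∈ (0,a)` (the witnesses'
  viscosities are NOT confined to a compact slab: sending steady witnesses to `ν ↓ 0` does not rescue a global steady producer), and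
  indeed (`isMeagre_loudSteadyLeaf_near_wild`) mean-zero steady loudness is MEAGRE in a neighbourhood of `c₀`.  This is the
  kernel-checked form of the compact-producer no-go of `Cruxes/RobustLoudUpgrade/Lines/malkin-cone-group-orbits-dead-c12.md` §3, without
  its compactness proviso: a counterexample to the crux needs a neighbourhood in which, for generic forces, EVERY mean-zero steady
  state at EVERY `ν ∈ (0,a)` is quiet (`meanDissipation < ε/2`) or energetic (`meanEnergy > 2E`).

What is NOT claimed: the registered residual `Poly.stub_residual_c14` (≡ the crux) is untouched; steady witnesses of non-zero mean and
genuinely time-periodic witnesses are outside `loudSteadyLeaf`.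

References: M. K. Fort, Publ. Math. Debrecen 2 (1951) 100–102 (points of lower semicontinuity); Oxtoby, *Measure and Category* (1980)
Ch. 9; Temam, *Navier–Stokes Equations* (1979) Ch. II §1; `Cruxes/RobustLoudUpgrade/STRATEGY-CENSUS.md` (W1, W4, R1–R4).
-/

-- `Summit.<Summit>.<Problem>` is the tree's mandated summit-side namespace (CONVENTIONS §2); for this
-- single-conjunct summit the two coincide, so the duplicate is deliberate.
set_option linter.dupNamespace false

noncomputable section

open scoped Topology ENNReal
open Filter Set Function TopologicalSpace MeasureTheory

namespace Summit.AnomalousDissipation.AnomalousDissipation.Theorems.RobustLoudUpgrade.Category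

open Literature.Analysis.FunctionSpaces Literature.Analysis.FunctionSpaces.Torus
open Literature.Analysis.FluidPDE
open Summit.AnomalousDissipation.AnomalousDissipation.Theses.BaireTransfer

/-! ## §1 The steady correspondence and the generic set -/

/-- The STEADY CORRESPONDENCE of the stratum `n`: pairs `(ν, U)` of a viscosity `ν ∈ [1/(n+1), n]` and a state `U ∈ H` with
`‖∇U‖² ≤ n²` which is a steady weak solution of `NS_ν(f_c)` (values in the compact set `[1/(n+1), n] × {‖∇U‖² ≤ n²}` of `ℝ × H`).
[folklore] -/
def steadyCorr (S : Finset (Fin 3 → ℤ)) (n : ℕ) (c : Coeff S) : Set (ℝ × energySpace (Fin 3)) :=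
  {q : ℝ × energySpace (Fin 3) | 1 / ((n : ℝ) + 1) ≤ q.1 ∧ q.1 ≤ (n : ℝ) ∧
    eGradNormSq (q.2.1 : UnitAddTorus (Fin 3) → EuclideanSpace ℝ (Fin 3)) ≤ ENNReal.ofReal ((n : ℝ) ^ 2) ∧
      Torus.IsSteadyWeakSolution q.1 (force S c) q.2}

/-- **The generic set** of the family `P_S`: coefficient vectors at which EVERY steady correspondence `steadyCorr S n` is lower
hemicontinuous.  It depends on `S` only. [folklore] -/
def genericSet (S : Finset (Fin 3 → ℤ)) : Set (Coeff S) :=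
  ⋂ n : ℕ, {c | LowerHemicontinuousAt (steadyCorr S n) c}

/-- The steady correspondence is upper hemicontinuous (registered stub `stub_steadyCorrespondenceUhc`). [folklore] -/
theorem upperHemicontinuous_steadyCorr (S : Finset (Fin 3 → ℤ)) (n : ℕ) : UpperHemicontinuous (steadyCorr S n) :=
  stub_steadyCorrespondenceUhc S n

/-- **`genericSet S` is RESIDUAL** (contains a dense `G_δ` of `P_S`): Fort's theorem (`stub_fort`) for each stratum — `ℝ × H` is
second countable (`L²` of the torus is separable) and regular — and countable intersection. [cite: Fort1951, Thm 2] -/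
theorem genericSet_mem_residual (S : Finset (Fin 3 → ℤ)) : genericSet S ∈ residual (Coeff S) := by
  haveI : Fact ((2 : ℝ≥0∞) ≠ ∞) := ⟨ENNReal.ofNat_ne_top⟩
  refine (countable_iInter_mem (ι := ℕ)).2 fun n => ?_
  have h : IsMeagre {c : Coeff S | ¬ LowerHemicontinuousAt (steadyCorr S n) c} :=
    stub_fort (steadyCorr S n) (upperHemicontinuous_steadyCorr S n)
  have hc : {c : Coeff S | ¬ LowerHemicontinuousAt (steadyCorr S n) c}ᶜ =
      {c | LowerHemicontinuousAt (steadyCorr S n) c} := by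
    ext; simp
  rw [← hc]
  exact h

/-- `genericSet S` is dense in `P_S`. [folklore] -/
theorem dense_genericSet (S : Finset (Fin 3 → ℤ)) : Dense (genericSet S) :=
  dense_of_mem_residual (genericSet_mem_residual S)

/-- The complement of `genericSet S` is meagre. [folklore] -/
theorem isMeagre_compl_genericSet (S : Finset (Fin 3 → ℤ)) : IsMeagre (genericSet S)ᶜ := by
  rw [IsMeagre, compl_compl]
  exact genericSet_mem_residual S

/-! ## §2 Generic persistence: the steady leaf upgrades with INTERIOR on the generic set -/

/-- **GENERIC PERSISTENCE (mean-zero steady leaf).**  At every `c ∈ genericSet S`, for ALL ceilings and budgets: a mean-zero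
classical steady witness of `NS_ν(f_c)` at some `ν ∈ (0,a)` with strict budgets makes `c` an INTERIOR point of `loud S a E ε`
(choose a stratum containing the witness; `stub_lscInterior`). [folklore] -/
theorem mem_interior_loud_of_mem_genericSet {S : Finset (Fin 3 → ℤ)} {c : Coeff S} (hc : c ∈ genericSet S) {a E ε ν : ℝ}
    (hν : 0 < ν) (hνa : ν < a) {u : UnitAddTorus (Fin 3) → EuclideanSpace ℝ (Fin 3)} {p : UnitAddTorus (Fin 3) → ℝ}
    (hst : Torus.IsSteadyNSState ν (force S c) u p) (h0 : HasZeroMean u) (hE : meanEnergy (fun _ : ℝ => u) < E)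
    (hD : ε < meanDissipation ν (fun _ : ℝ => u)) : c ∈ interior (loud S a E ε) := by
  -- a stratum containing the witness: `1/(n+1) ≤ ν ≤ n`, `‖∇u‖² ≤ n²`
  obtain ⟨n, hn⟩ := exists_nat_ge (max (max (1 / ν) ν) (max (gradNormSq u) 1))
  have h1 : 1 / ν ≤ n := (le_max_left _ _).trans ((le_max_left _ _).trans hn)
  have h2 : ν ≤ n := (le_max_right _ _).trans ((le_max_left _ _).trans hn)
  have h3 : gradNormSq u ≤ n := (le_max_left _ _).trans ((le_max_right _ _).trans hn)
  have h4 : (1 : ℝ) ≤ n := (le_max_right _ _).trans ((le_max_right _ _).trans hn)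
  have h1' : 1 / ((n : ℝ) + 1) ≤ ν := by
    rw [div_le_iff₀ (by positivity)]
    have : 1 ≤ ν * n := by rwa [div_le_iff₀' hν] at h1
    nlinarith
  have h3' : gradNormSq u ≤ (n : ℝ) ^ 2 := h3.trans (by nlinarith)
  exact stub_lscInterior S n a E ε c (mem_iInter.1 hc n) ⟨ν, hν, hνa, h1', h2, u, p, hst, h0, h3', hE, hD⟩

/-- **Registered sub-goal `genericSteady_interior` (lead c15, wave 2)** — the def-free existential form: for every frequency set `S`
there is a RESIDUAL set `G ⊆ P_S` of forces such that for all ceilings `a` and budgets `E, ε`, every `c ∈ G` carrying a mean-zero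
classical steady state of `NS_ν(f_c)` at some `ν ∈ (0,a)` with `meanEnergy < E` and `meanDissipation > ε` is an INTERIOR point of
`loud S a E ε`. [folklore] -/
theorem genericSteady_interior : ∀ (S : Finset (Fin 3 → ℤ)), ∃ G : Set (Coeff S), G ∈ residual (Coeff S) ∧
    ∀ (a E ε : ℝ) (c : Coeff S), c ∈ G → ∀ (ν : ℝ), 0 < ν → ν < a →
      ∀ (u : UnitAddTorus (Fin 3) → EuclideanSpace ℝ (Fin 3)) (p : UnitAddTorus (Fin 3) → ℝ),
        Torus.IsSteadyNSState ν (force S c) u p → HasZeroMean u → meanEnergy (fun _ : ℝ => u) < E →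
          ε < meanDissipation ν (fun _ : ℝ => u) → c ∈ interior (loud S a E ε) :=
  fun S => ⟨genericSet S, genericSet_mem_residual S, fun _ _ _ _ hc _ hν hνa _ _ hst h0 hE hD =>
    mem_interior_loud_of_mem_genericSet hc hν hνa hst h0 hE hD⟩

/-- A mean-zero steady witness with POSITIVE dissipation has positive energy (through its weak state `U ∈ V`:
`meanDissipation = (U, f) ≤ ‖U‖·‖f‖₂` and `meanEnergy = ‖U‖²`). [folklore] -/
theorem meanEnergy_pos_of_meanDissipation_pos {S : Finset (Fin 3 → ℤ)} {c : Coeff S} {ν : ℝ}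
    {u : UnitAddTorus (Fin 3) → EuclideanSpace ℝ (Fin 3)} {p : UnitAddTorus (Fin 3) → ℝ}
    (hst : Torus.IsSteadyNSState ν (force S c) u p) (h0 : HasZeroMean u) (hD : 0 < meanDissipation ν (fun _ : ℝ => u)) :
    0 < meanEnergy (fun _ : ℝ => u) := by
  obtain ⟨U, -, -, hEq, hDq⟩ := exists_weak_of_isSteadyNSState (CensusInterior.isSmooth_force c) hst h0
  rw [hEq]
  rw [hDq] at hD
  have hcs : Torus.pairing U.1 (force S c) ≤ ‖U‖ * ‖(CensusInterior.memLp_force c).toLp (force S c)‖ :=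
    (le_abs_self _).trans (Torus.abs_pairing_coe_le (CensusInterior.memLp_force c) U)
  have hU : 0 < ‖U‖ := by
    by_contra h
    have h' : ‖U‖ = 0 := le_antisymm (not_lt.1 h) (norm_nonneg _)
    rw [h', zero_mul] at hcs
    linarith
  positivity

/-- **The crux's shape on the generic set.**  For `0 < ε`, every `c ∈ genericSet S` with a mean-zero steady loud witness of
`LOUD^{(0,a)}(S,E,ε)` is an INTERIOR point of `LOUD^{(0,a)}(S,2E,ε/2)` — for every `S` (no stock), uniformly in the budgets and
the ceiling (in particular at every level `a = 1/(j+1)`). [folklore] -/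
theorem loudSteadyLeaf_inter_genericSet_subset (S : Finset (Fin 3 → ℤ)) (a E ε : ℝ) (hε : 0 < ε) :
    loudSteadyLeaf S a E ε ∩ genericSet S ⊆ interior (loud S a (2 * E) (ε / 2)) := by
  rintro c ⟨⟨ν, hν, hνa, u, p, hst, h0, hEu, hDu⟩, hc⟩
  have hEpos : 0 < E :=
    (meanEnergy_pos_of_meanDissipation_pos hst h0 (hε.trans_le hDu)).trans_le hEu
  exact mem_interior_loud_of_mem_genericSet hc hν hνa hst h0 (by linarith) (by linarith)

/-- Equivalently: the mean-zero steady leaf of the crux's wild residual avoids the generic set — it is contained in the MEAGRE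
set `(genericSet S)ᶜ`, the same exceptional set for all budgets and levels. [folklore] -/
theorem steadyLeaf_residual_subset_compl_genericSet (S : Finset (Fin 3 → ℤ)) (a E ε : ℝ) (hε : 0 < ε) :
    loudSteadyLeaf S a E ε \ closure (interior (loud S a (2 * E) (ε / 2))) ⊆ (genericSet S)ᶜ := by
  rintro c ⟨hl, hn⟩ hc
  exact hn (subset_closure (loudSteadyLeaf_inter_genericSet_subset S a E ε hε ⟨hl, hc⟩))

/-! ## §3 Baire consequences: the primed form for the steady leaf; steady loudness is meagre near a wild force -/

/-- **The primed form holds for the steady leaf**: `interior (loudSteadyLeaf S a E ε) ⊆ closure (interior (loud S a E ε))`.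
If EVERY force of an open set carries a mean-zero steady witness of budgets `(E, ε)` at SOME viscosity `ν ∈ (0,a)` — the viscosity
may depend on the force and is NOT confined to a compact slab — then robustly loud forces are dense in that open set (non-empty
open sets of the Baire space `P_S` are not meagre; dichotomy `interior_loud_nonempty_or_isMeagre`). [folklore] -/
theorem interior_loudSteadyLeaf_subset (S : Finset (Fin 3 → ℤ)) (a E ε : ℝ) :
    interior (loudSteadyLeaf S a E ε) ⊆ closure (interior (loud S a E ε)) := by
  intro c hc
  rw [mem_closure_iff_nhds]
  intro t ht
  -- a non-empty open `W ⊆ t ∩ loudSteadyLeaf` around `c`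
  obtain ⟨W, hWsub, hW, hcW⟩ := mem_nhds_iff.1 (inter_mem ht (mem_interior_iff_mem_nhds.1 hc))
  rcases interior_loud_nonempty_or_isMeagre S a E ε W with ⟨x, hx, hxW⟩ | hm
  · exact ⟨x, (hWsub hxW).1, hx⟩
  · have hWl : loudSteadyLeaf S a E ε ∩ W = W :=
      inter_eq_right.2 fun x hx => (hWsub hx).2
    rw [hWl] at hm
    exact absurd hm (not_isMeagre_of_isOpen hW ⟨c, hcW⟩)

/-- **At a wild force, nearby forces lack steady witnesses.**  If `c₀ ∉ closure (interior (loud S a E' ε'))` (for the crux: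
`E' = 2E`, `ε' = ε/2`), then `c₀ ∉ interior (loudSteadyLeaf S a E' ε')`: every neighbourhood of `c₀` contains forces carrying NO
mean-zero classical steady state with `meanEnergy ≤ E'`, `meanDissipation ≥ ε'` at ANY viscosity `ν ∈ (0,a)`. [folklore] -/
theorem not_mem_interior_loudSteadyLeaf_of_wild {S : Finset (Fin 3 → ℤ)} {a E' ε' : ℝ} {c₀ : Coeff S}
    (h : c₀ ∉ closure (interior (loud S a E' ε'))) : c₀ ∉ interior (loudSteadyLeaf S a E' ε') :=
  fun hc => h (interior_loudSteadyLeaf_subset S a E' ε' hc)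

/-- **Near a wild force, mean-zero steady loudness is meagre.**  If `c₀ ∉ closure (interior (loud S a E' ε'))` then on the open
neighbourhood `V = (closure (interior (loud S a E' ε')))ᶜ` of `c₀` the mean-zero steady-loud forces form a MEAGRE set: generic
forces near a wild force have, at EVERY `ν ∈ (0,a)`, only mean-zero steady states that are quiet (`meanDissipation < ε'`) or
energetic (`meanEnergy > E'`) — although steady states exist at every viscosity (Temam 1979, Ch. II Thm 1.2, in tree). [folklore] -/
theorem isMeagre_loudSteadyLeaf_near_wild (S : Finset (Fin 3 → ℤ)) (a E' ε' : ℝ) :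
    IsMeagre (loudSteadyLeaf S a E' ε' ∩ (closure (interior (loud S a E' ε')))ᶜ) := by
  rcases interior_loud_nonempty_or_isMeagre S a E' ε' (closure (interior (loud S a E' ε')))ᶜ with ⟨x, hx, hxV⟩ | hm
  · exact absurd (subset_closure hx) hxV
  · exact hm

/-! ### §3′ Erratum on the reading of §3 (lead c15, appended)

Of the three statements of §3 only `isMeagre_loudSteadyLeaf_near_wild` carries content (it uses the `F_σ` structure: near a wild
force the mean-zero steady-loud set is MEAGRE, not merely without interior).  The first two are ELEMENTARY and hold for every subset
of `loud`: `interior (loudSteadyLeaf S a E ε) ⊆ interior (loud S a E ε) ⊆ closure (interior (loud S a E ε))` by monotonicity alone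
(`interior_loudSteadyLeaf_subset'` below), and likewise a wild force trivially has nearby forces outside `loud` altogether.  In
particular the "compact-producer no-go" of `Lines/malkin-cone-group-orbits-dead-c12.md` §3 is void as a constraint: an open ball of
relaxed-loud forces near `c₀`, produced by ANY witnesses, lies in `interior LOUD₂` by definition — a global producer (census W4) is
exactly what the residual asks for, and nothing forbids it.  What the category package adds at a wild force is the GENERICITY
statement: outside the meagre set `(genericSet S)ᶜ ∪ (loudSteadyLeaf ∩ V)` (with `V` the wild neighbourhood), nearby forces have, at
every `ν ∈ (0,a)`, only quiet-or-energetic mean-zero steady states, and every strictly-loud mean-zero steady state they might have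
would be robust. -/

/-- The elementary form of `interior_loudSteadyLeaf_subset` (monotonicity only; recorded to make the erratum above checkable). [folklore] -/
theorem interior_loudSteadyLeaf_subset' : ∀ (S : Finset (Fin 3 → ℤ)) (a E ε : ℝ),
    interior (loudSteadyLeaf S a E ε) ⊆ closure (interior (loud S a E ε)) :=
  fun S a E ε => (interior_mono (loudSteadyLeaf_subset_loud S a E ε)).trans subset_closure

end Summit.AnomalousDissipation.AnomalousDissipation.Theorems.RobustLoudUpgrade.Category

end
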